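import Literature.NumberTheory.GaloisCohomology.Howard2004.TowerMorphismPushforward
import Literature.NumberTheory.GaloisRepresentations.GaloisCohomologyScalarActionLocalConditions
import HarnessLib

/-!
# Howard 2004, Def. 1.2.3: the `R`-module structure on `𝐊𝐒(T, 𝓕, 𝓛)` — the scalar `r • κ` of a Kolyvagin
# system over the general tower setting, as the pushforward along the endomorphism `r • id`

Topic `NumberTheory/GaloisCohomology/Howard2004` (cell `pub/bsd-print-x9`, literature seat g33, TRANCHE 6a; sequel
of LEAD's `TowerMorphism` / `TowerMorphismPushforward` (`CoeffTowerSetting.Hom`, `Hom.pushforward`) and of lit's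
`KolyvaginSystemScalars` (one level)).  Definitions with bodies and proved theorems; no named fact, no instance, no
`sorry`.

THE POINT.  Howard, Def. 1.2.3 [arXiv p. 7, L7–9]: «… the `R`-module of Kolyvagin systems `𝐊𝐒(T, 𝓕, 𝓛)`».  In
the tree a Kolyvagin system over a tower setting `S : CoeffTowerSetting p K R …` is the record
`CoeffTowerSetting.KolyvaginSystem` (level systems + compatibility + bottom class `κ.one ∈ lim_k H¹_𝓕(K, T^{(k)})`),
and the cell's `Λ`-adic argument (CGLS 2022 Rem. 4.1.4: «`κ_∞` and `κ₁^{Hg}` generate the same `Λ`-submodule», lit's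
`CastellaGrossiLeeSkinner2022.exists_kolyvaginSystem_one_eq_of_thm411`) needs the scalar `r • κ` with
`(r • κ).one = r • κ.one`.  This file builds it WITHOUT new axioms on the slots: multiplication by `r ∈ R` on every
level `T^{(k)}` and on every Kolyvagin quotient `T^{(k)}/I_n T^{(k)}` is a morphism of tower settings `S → S` over
`id_R` (`CoeffTowerSetting.smulHom`) — `f_k = r • id`, `fq_{k,n} = r • id` — as soon as (a) the levels are
`R_k`-linear (`hρk`), (b) the level Selmer structures are `R`-submodules place by place (Howard Def. 1.1.1 «an
`R`-submodule `H¹_𝓕(K_v, M)`»; lit's `SelmerStructure.IsScalarStable`, hypothesis `hcond`), and (c) the finite–singular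
slots are natural in the module along equivariant endomorphisms (lit's `LevelData.FsNaturalAt n n λ`, hypothesis
`hfs`; automatic for the tame slots `tameSlotOn`, `FiniteSingularTameTower.tameSlotOn_natural_cohomologyMap`); and then
**`KolyvaginSystem.smul … r κ := (S.smulHom … r).pushforward κ`** is LEAD's landed pushforward, with
`(smul r κ).one = S.T.smulFamily r κ.one` DEFINITIONALLY (`ContinuousRep.cohomologyMap` of `r • id` IS V2's
`scalarMapH1 r`, `cohomologyMap_smul_id`).

Not here (no consumer): additivity / multiplicativity of `r ↦ r • κ` as equalities of records (the level classes
agree by `LevelData.mapFamily` linearity; state on demand), the module axioms.  BSD is not proved by any of this.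

References: B. Howard, *The Heegner point Kolyvagin system*, Compositio Math. **140** (2004), Def. 1.1.1, 1.1.8,
1.2.3, Rem. 1.2.4 (arXiv:1202.6340 pp. 5–7) [Howard2004HeegnerKolyvagin]; J.-P. Serre, *Galois Cohomology* (1997),
I §2.2, §5.1 [SerreGaloisCohomology1997].
-/

set_option autoImplicit false

noncomputable section

open Function NumberField IsDedekindDomain Field
open scoped NumberField TensorProduct

namespace Literature.NumberTheory.GaloisCohomology.Howard2004

open Literature.NumberTheory.GaloisRepresentations Literature.NumberTheory.GaloisRepresentations.DiscreteGaloisModule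

/-! ## §1 `H¹(r • id) = H¹(r•)` -/

section ScalarMap

variable {K : Type} [Field K] [NumberField K] {M : Type} [AddCommGroup M] [TopologicalSpace M]
  [DiscreteTopology M] {R : Type} [CommRing R] [Module R M]

omit [NumberField K] in
/-- The scalar endomorphism `r • id` is equivariant on an `R`-linear module.
[cite: Howard2004HeegnerKolyvagin, §1 conventions Mod_{R,K} (arXiv p. 5, L3–24)] -/
theorem smul_id_equivariant (ρ : DiscreteGaloisModule K M) (hρ : ρ.IsScalarLinear R) (r : R)
    (σ : absoluteGaloisGroup K) (x : M) :
    (r • LinearMap.id : M →ₗ[R] M).toAddMonoidHom (ρ σ x) = ρ σ ((r • LinearMap.id : M →ₗ[R] M).toAddMonoidHom x) := by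
  simp [hρ σ r x]

omit [NumberField K] in
/-- **`H¹(K, r • id) = H¹(r•)`**: the tree's `ContinuousRep.cohomologyMap` of the scalar endomorphism IS V2's
`scalarMapH1` (definitionally). [cite: SerreGaloisCohomology1997, Ch. I §2.2 and §5.1] [cite: Howard2004HeegnerKolyvagin, Def. 1.1.1 (arXiv p. 5)] -/
theorem cohomologyMap_smul_id (ρ : DiscreteGaloisModule K M) (hρ : ρ.IsScalarLinear R) (r : R) :
    ContinuousRep.cohomologyMap ρ ρ (r • LinearMap.id : M →ₗ[R] M).toAddMonoidHom continuous_of_discreteTopology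
      (smul_id_equivariant ρ hρ r) 1 = galoisCohomology.scalarMapH1 ρ hρ r :=
  rfl

/-- The same at a place `v`: `H¹(K_v, r • id) = H¹(r•)` on `H¹(K_v, M)`.
[cite: SerreGaloisCohomology1997, Ch. I §2.2 and §5.1] [cite: Howard2004HeegnerKolyvagin, Def. 1.1.1 (arXiv p. 5)] -/
theorem cohomologyMap_toLocal_smul_id (ρ : DiscreteGaloisModule K M) (hρ : ρ.IsScalarLinear R) (r : R) (v : Place K)
    (h : ∀ (σ : absoluteGaloisGroup (Place.Completion v)) (x : M),
      (r • LinearMap.id : M →ₗ[R] M).toAddMonoidHom (ρ.toLocal v σ x) =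
        ρ.toLocal v σ ((r • LinearMap.id : M →ₗ[R] M).toAddMonoidHom x)) :
    ContinuousRep.cohomologyMap (ρ.toLocal v) (ρ.toLocal v) (r • LinearMap.id : M →ₗ[R] M).toAddMonoidHom
      continuous_of_discreteTopology h 1 =
    galoisCohomology.scalarMapH1 (ρ.toLocal v) (hρ.restrictField (Place.Completion v)) r :=
  rfl

end ScalarMap

/-! ## §2 Multiplication by `r` as a morphism of tower settings `S → S`; the scalar `r • κ` -/

namespace CoeffTowerSetting

variable {p : ℕ} [Fact p.Prime] {K : Type} [Field K] [NumberField K]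
  {R : Type} [CommRing R] [IsLocalRing R] [Algebra ℤ_[p] R]
  {N : ℕ → Type} [∀ k, AddCommGroup (N k)] [∀ k, TopologicalSpace (N k)]
  [∀ k, DiscreteTopology (N k)] [∀ k, Module R (N k)]
  {Rk : ℕ → Type} [∀ k, CommRing (Rk k)] [∀ k, IsLocalRing (Rk k)] [∀ k, TopologicalSpace (Rk k)]
  [∀ k, DiscreteTopology (Rk k)] [∀ k, Algebra ℤ_[p] (Rk k)] [∀ k, Algebra R (Rk k)]
  [∀ k, Module (Rk k) (N k)] [∀ k, IsScalarTower R (Rk k) (N k)]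
  {Nbar : Type} [AddCommGroup Nbar] [TopologicalSpace Nbar] [DiscreteTopology Nbar]
  [∀ k, Module (Rk k) Nbar]
  {Nq : ℕ → Finset (HeightOneSpectrum (𝓞 K)) → Type} [∀ k n, AddCommGroup (Nq k n)]
  [∀ k n, TopologicalSpace (Nq k n)] [∀ k n, DiscreteTopology (Nq k n)]
  [∀ k n, Module (Rk k) (Nq k n)] [∀ k n, Module R (Nq k n)]
  [∀ k n, IsScalarTower R (Rk k) (Nq k n)]

variable (S : CoeffTowerSetting p K R N Rk Nbar Nq)
  (hρk : ∀ k, (S.T.ρ k).IsScalarLinear (Rk k))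
  (hcond : ∀ k, (S.t k).cond.IsScalarStable (S.T.hlin k))
  (hfs : ∀ k (n : Finset (HeightOneSpectrum (𝓞 K))) (v : HeightOneSpectrum (𝓞 K)), (S.LD k).FsNaturalAt n n v)

/-- **Multiplication by `r ∈ R` as a morphism of tower settings `S → S` over `id_R`** (Rem. 1.2.4 with
`T′ = T`, `f = r • id`): level maps `f_k = r • id : T^{(k)} → T^{(k)}` (`R`-linear, equivariant, compatible with the
reductions), quotient maps `fq_{k,n} = r • id : T^{(k)}/I_n → T^{(k)}/I_n`; (i) `𝓛′ = 𝓛`; (ii)+(iii) `H¹(r•)` preserves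
every local condition — the `R`-submodule property of Def. 1.1.1 (`hcond`); (iv) the finite–singular slots commute
with `H¹(r•)` on the finite classes — naturality in the module (`hfs`, lit's `FsNaturalAt n n λ`).
[cite: Howard2004HeegnerKolyvagin, Def. 1.1.1, Def. 1.1.8, Def. 1.2.3 «the R-module of Kolyvagin systems», Rem. 1.2.4 (arXiv pp. 5–7)] -/
def smulHom (r : R) : Hom (RingHom.id R) S S where
  f k := (r • LinearMap.id : N k →ₗ[R] N k).toAddMonoidHom
  f_smul k s x := by
    change r • (s • x) = s • (r • x)
    exact smul_comm r s x
  f_equivariant k σ x := smul_id_equivariant (S.T.ρ k) (S.T.hlin k) r σ x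
  f_red k x := by
    change r • S.T.red k x = S.T.red k (r • x)
    rw [LinearMap.map_smul]
  fq k n := ((algebraMap R (Rk k) r) • LinearMap.id : Nq k n →ₗ[Rk k] Nq k n).toAddMonoidHom
  fq_comp k n x := by
    change algebraMap R (Rk k) r • (S.LD k).π n x = (S.LD k).π n (r • x)
    rw [← algebraMap_smul (Rk k) r x, LinearMap.map_smul]
  fq_equivariant k n σ y := by
    change algebraMap R (Rk k) r • (S.LD k).ρq n σ y = (S.LD k).ρq n σ (algebraMap R (Rk k) r • y)
    exact ((S.LD k).isScalarLinear (hρk k) n σ _ y).symm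
  fq_rq k n y := by
    change algebraMap R (Rk k) r • S.rq k n y = S.rq k n (algebraMap R (Rk (k + 1)) r • y)
    rw [algebraMap_smul, algebraMap_smul, LinearMap.map_smul]
  jbar_eq := rfl
  primes_subset := subset_rfl
  cond_le k v := by
    rintro _ ⟨x, hx, rfl⟩
    exact hcond k v r hx
  fs_compat k n v c hc :=
    hfs k n v ((algebraMap R (Rk k) r) • LinearMap.id) (fun σ y ↦ by
      change algebraMap R (Rk k) r • GaloisRep.toLocal v ((S.LD k).ρq n) σ y =
        GaloisRep.toLocal v ((S.LD k).ρq n) σ (algebraMap R (Rk k) r • y)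
      exact smul_toLocal_comm ((S.LD k).isScalarLinear (hρk k) n) v _ σ y) c hc

/-- The level map of `smulHom r` is `r • id`. [cite: Howard2004HeegnerKolyvagin, Rem. 1.2.4 (arXiv p. 7)] -/
@[simp] theorem smulHom_f_apply (r : R) (k : ℕ) (x : N k) : (S.smulHom hρk hcond hfs r).f k x = r • x := rfl

/-- The quotient-level map of `smulHom r` is `r • id` (`= (algebraMap R R_k r) • id`).
[cite: Howard2004HeegnerKolyvagin, Rem. 1.2.4 (arXiv p. 7)] -/
@[simp] theorem smulHom_fq_apply (r : R) (k : ℕ) (n : Finset (HeightOneSpectrum (𝓞 K))) (y : Nq k n) :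
    (S.smulHom hρk hcond hfs r).fq k n y = r • y := by
  change algebraMap R (Rk k) r • y = r • y
  exact algebraMap_smul (Rk k) r y

/-- `H¹(K, f_k) = H¹(r•)` on `H¹(K, T^{(k)})` for the scalar morphism.
[cite: Howard2004HeegnerKolyvagin, Rem. 1.2.4 (iii) (arXiv p. 7)] [cite: SerreGaloisCohomology1997, Ch. I §5.1] -/
theorem smulHom_fH1 (r : R) (k : ℕ) :
    (S.smulHom hρk hcond hfs r).fH1 k = galoisCohomology.scalarMapH1 (S.T.ρ k) (S.T.hlin k) r :=
  rfl

variable (hL : ∀ k, (S.t k).primes = S.L)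

/-- **The scalar `r • κ` of a Kolyvagin system** `κ ∈ 𝐊𝐒(T, 𝓕, 𝓛)` over the tower setting (Def. 1.2.3: `𝐊𝐒` is an
`R`-module): the pushforward of `κ` along `smulHom r` — level classes `(r • ·) ⊗ 1` of the level classes, bottom
class `r • κ_1`. [cite: Howard2004HeegnerKolyvagin, Def. 1.2.3 «the R-module of Kolyvagin systems KS(T, F, L)» (arXiv p. 7, L7–9) and Rem. 1.2.4] -/
def KolyvaginSystem.smul (r : R) (κ : S.KolyvaginSystem) : S.KolyvaginSystem :=
  (S.smulHom hρk hcond hfs r).pushforward hL hL κ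

/-- **`(r • κ).one = r • κ.one`** (the `R`-action `AdicTower.smulFamily` on `lim_k H¹(K, T^{(k)})`).
[cite: Howard2004HeegnerKolyvagin, Def. 1.2.3 and §2.2 (𝔖 as a Λ-module) (arXiv p. 7, p. 16)] -/
@[simp] theorem KolyvaginSystem.smul_one (r : R) (κ : S.KolyvaginSystem) :
    (KolyvaginSystem.smul S hρk hcond hfs hL r κ).one = S.T.smulFamily r κ.one :=
  rfl

/-- The level classes of `r • κ` on `𝓝(𝓛)`: `(H¹(r•) ⊗ 1) κ^{(k)}_n` (LEAD's `levelMap` of the scalar morphism).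
[cite: Howard2004HeegnerKolyvagin, Def. 1.2.3 and Rem. 1.2.4 (arXiv p. 7)] -/
theorem KolyvaginSystem.smul_κ (r : R) (κ : S.KolyvaginSystem) (k : ℕ) :
    (KolyvaginSystem.smul S hρk hcond hfs hL r κ).κ k = (S.smulHom hρk hcond hfs r).pushforwardLevel k (κ.κ k) :=
  rfl

end CoeffTowerSetting

end Literature.NumberTheory.GaloisCohomology.Howard2004

end
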